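import Literature.Probability.RandomPlanarGeometry.RestrictionMeasures
import Mathlib.Analysis.Convex.Star
import HarnessLib

/-!
# Brownian bubbles at `0` ([LSW] §7.1; Lawler 2005 §5.5): the space `Ω_b`, jets of `Φ_A` at `0`, the bubble measure `μ`

Level 4 of the decomposition of the named fact
`Literature.Probability.RandomPlanarGeometry.IsRestrictionMeasure.eq_five_eighths_of_simple` /
`…eq_five_eighths_of_outer_simple` (files `RestrictionMeasures`, `RestrictionMeasuresFiveEighths`,
`SLEKappaRho`): the objects behind its `α > 5/8` leaf
`IsRestrictionMeasure.ae_interior_nonempty_of_gt_five_eighths` ("`P_α`-a.e. configuration has an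
interior point"), which rests on [LSW] Thm. 7.3 — `P_α`, `α > 5/8`, is the law of an SLE_κ
curve with a Poisson cloud of Brownian bubbles added (file `SLEBubbles`). Sources:

* G. F. Lawler, O. Schramm, W. Werner, *Conformal restriction: the chordal case*, J. Amer. Math.
  Soc. **16** (2003) 917–955, arXiv:math/0209343 (**[LSW]**), §7.1 "Brownian bubbles" (arXiv
  pp. 27–28): the measure `ν` on bubbles hanging at infinity, `μ` "the measure on Brownian
  bubbles at `0` as the image of `ν` under the inversion `z ↦ −1/z`. It is a measure on the set
  of bounded `K ⊂ ℍ` with `cl K = K ∪ {0}`. By (5.1) we have for `A ∈ 𝒬*`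
  (7.2) `μ[K ∩ A ≠ ∅] = −S g_A(0)/6`. We may think of `μ` as a measure on the space `Ω_b` of
  connected bounded sets `K ⊂ ℍ` such that `cl K = K ∪ {0}` and `ℍ ∖ K` is connected"; and §5
  (5.1): "`S g_A(0) = −6 a({−z⁻¹ : z ∈ A})`", `S` the Schwarzian derivative, `a` the half-plane
  capacity;
* G. F. Lawler, *Conformally Invariant Processes in the Plane*, AMS (2005) (**[Lawler]**), §5.5
  "Boundary bubbles", Prop. 5.22: for a simply connected `D ⊆ ℍ` containing a half-disc at `0`
  and `f : D → ℍ` conformal with `f(0) = 0`, "`μ^bub_ℍ(0){γ : γ(0, t_γ) ⊄ D} = hcap(A) =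
  −Sf(0)/6`", with, in its proof, `f(z) = z + x z² + [x² − hcap(A)] z³ + ⋯` when `f'(0) = 1`.

Contents:

* `Literature.Probability.RandomPlanarGeometry.BubbleConfig` — **`Ω_b`** verbatim, with the
  σ-field generated by the avoidance events `{K ∩ A = ∅}`, `A ∈ 𝒬*` (as for `Ω`, `Ω₊`), the
  hitting events `BubbleConfig.hit A = {K ∩ A ≠ ∅}` of (7.2), and the vertical segment `(0, i]`
  as an example (non-vacuity, PROVED);
* `Literature.Probability.RandomPlanarGeometry.HasRestrictionJet A Φ d c₂ c₃` — the **third-order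
  jet of `Φ_A` at `0`**: `Φ_A(z) = d z + c₂ z² + c₃ z³ + o(z³)` as `z → 0` in `ℍ ∖ A`, with real
  coefficients (the restriction map extends analytically across `ℝ` near `0` by Schwarz
  reflection and is real on `ℝ`); it refines the tree's `HasRestrictionDeriv A Φ d`
  (`HasRestrictionJet.hasRestrictionDeriv`, PROVED) and the jet of `Φ_∅ = id` is `(1, 0, 0)`
  (PROVED); existence of the jet for every `A ∈ 𝒬*` is the NAMED FACT
  `IsStarHull.exists_hasRestrictionJet` ([LSW] p. 7, [Lawler] proof of Prop. 5.22);
* `Literature.Probability.RandomPlanarGeometry.bubbleMass d c₂ c₃ = c₂²/d² − c₃/d` — the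
  right-hand side of (7.2): `−SΦ_A(0)/6` for `SΦ = Φ‴/Φ′ − (3/2)(Φ″/Φ′)²`, `Φ′(0) = d`,
  `Φ″(0) = 2c₂`, `Φ‴(0) = 6c₃` (`S g_A = S Φ_A`, the Schwarzian being invariant under the
  translation `Φ_A = g_A − g_A(0)`); for `d = 1` this is [Lawler]'s `x² − (x² − hcap A) = hcap A`;
* `Literature.Probability.RandomPlanarGeometry.IsBrownianBubbleMeasure μ` — **the Brownian bubble
  measure, characterised by (7.2)**: a measure on `Ω_b` with `μ[K ∩ A ≠ ∅] = −SΦ_A(0)/6` for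
  every `A ∈ 𝒬*` (and every restriction map / jet of `A`, all of which agree). The paper's
  CONSTRUCTION of `μ` (the limit `ν = (1/π) lim_{y→∞} y ∫_ℝ P̂^{x+iy} dx` of filled Brownian
  excursions, inverted) is not reproduced: its existence is the NAMED FACT
  `exists_isBrownianBubbleMeasure` ([LSW] §7.1 with (7.2); [Lawler] §5.5, Prop. 5.22). The
  hitting identity is exactly what the proof of Thm. 7.3 uses of `μ` ("where `K` is independent
  from `γ` and has law `μ`", (7.2) ⇒ `P[… ∩ A ≠ ∅ | g_t] = −Sh_t(W_t)/6`);
* `Literature.Probability.RandomPlanarGeometry.IsBrownianBubbleMeasure.ae_interior_nonempty` —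
  NAMED FACT (folklore): `μ`-almost every bubble has an interior point (a bubble is the filling
  of a Brownian loop rooted at `0`, and a planar Brownian loop disconnects an open set of points
  from `∞`); this is the property of the bubbles through which `P_α`, `α > 5/8`, fails to be
  supported on simple curves.

Design note. Characterising `μ` by (7.2) instead of constructing it keeps every definition real
and sorry-free while isolating the analytic content (Brownian excursions from every point of
`ℍ`, their fillings, the limit defining `ν`) in one existence fact; (7.2) determines `μ` on the
σ-field generated by the hitting events (inclusion–exclusion on the π-system of finite
intersections of hitting events, each of finite mass, and `Ω_b` is a countable union of hitting
events of `*`-hulls since `𝒬*` has a countable subfamily covering `ℍ`,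
`exists_countable_isStarHull_cover`), which is not proved here.
-/

noncomputable section

open Set Filter Topology MeasureTheory Metric
open UpperHalfPlane (upperHalfPlaneSet)
open scoped NNReal ENNReal

namespace Literature.Probability.RandomPlanarGeometry

/-! ### The space `Ω_b` of bubbles at `0` ([LSW] §7.1) -/

/-- **[LSW] §7.1** (p. 28): "the space `Ω_b` of connected bounded sets `K ⊂ ℍ` such that
`cl K = K ∪ {0}` and `ℍ ∖ K` is connected" (`ℍ` the open upper half-plane).
[cite: LawlerSchrammWerner2003Restriction, §7.1 (p. 28, Ω_b)] -/
def bubbleConfigs : Set (Set ℂ) :=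
  {K | K ⊆ upperHalfPlaneSet ∧ Bornology.IsBounded K ∧ IsConnected K ∧ closure K = K ∪ {0} ∧
    IsConnected (upperHalfPlaneSet \ K)}

/-- The type of bubbles `K ∈ Ω_b` ([LSW] §7.1), carrying the Brownian bubble measure `μ`.
[cite: LawlerSchrammWerner2003Restriction, §7.1 (p. 28, Ω_b)] -/
def BubbleConfig : Type := {K : Set ℂ // K ∈ bubbleConfigs}

namespace BubbleConfig

/-- The underlying set of a bubble. [folklore] -/
instance instCoe : CoeOut BubbleConfig (Set ℂ) := ⟨Subtype.val⟩

variable (K : BubbleConfig)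

/-- A bubble lies in the open upper half-plane. [folklore] -/
theorem subset_upperHalfPlaneSet : (K : Set ℂ) ⊆ upperHalfPlaneSet := K.2.1

/-- A bubble is bounded. [folklore] -/
theorem isBounded : Bornology.IsBounded (K : Set ℂ) := K.2.2.1

/-- A bubble is connected. [folklore] -/
theorem isConnected : IsConnected (K : Set ℂ) := K.2.2.2.1

/-- The closure of a bubble is the bubble together with its root `0`. [folklore] -/
theorem closure_eq : closure (K : Set ℂ) = (K : Set ℂ) ∪ {0} := K.2.2.2.2.1

/-- The complement of a bubble in `ℍ` is connected. [folklore] -/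
theorem isConnected_diff : IsConnected (upperHalfPlaneSet \ (K : Set ℂ)) := K.2.2.2.2.2

/-- The root `0` lies in the closure of a bubble. [folklore] -/
theorem zero_mem_closure : (0 : ℂ) ∈ closure (K : Set ℂ) := by
  rw [K.closure_eq]
  exact Or.inr rfl

/-- The root does not belong to the bubble itself (bubbles lie in the open half-plane). [folklore] -/
theorem zero_notMem : (0 : ℂ) ∉ (K : Set ℂ) := fun h ↦ by
  have : (0 : ℝ) < (0 : ℂ).im := K.subset_upperHalfPlaneSet h
  simp at this

/-- A bubble is nonempty. [folklore] -/
theorem nonempty : (K : Set ℂ).Nonempty := K.isConnected.nonempty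

/-- The event "the bubble avoids `A`", `{K ∩ A = ∅}`. [cite: LawlerSchrammWerner2003Restriction, §7.1 (p. 28)] -/
def avoid (A : Set ℂ) : Set BubbleConfig := {K | Disjoint (K : Set ℂ) A}

/-- The event "the bubble hits `A`", `{K ∩ A ≠ ∅}` of [LSW] (7.2). [cite: LawlerSchrammWerner2003Restriction, §7.1 eq. (7.2) (p. 28)] -/
def hit (A : Set ℂ) : Set BubbleConfig := {K | ¬ Disjoint (K : Set ℂ) A}

variable {K}

/-- Membership in the avoidance event. [folklore] -/
@[simp] theorem mem_avoid {A : Set ℂ} : K ∈ avoid A ↔ Disjoint (K : Set ℂ) A := Iff.rfl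

/-- Membership in the hitting event. [folklore] -/
@[simp] theorem mem_hit {A : Set ℂ} : K ∈ hit A ↔ ¬ Disjoint (K : Set ℂ) A := Iff.rfl

/-- Hitting is the complement of avoiding. [folklore] -/
theorem hit_eq_compl (A : Set ℂ) : hit A = (avoid A)ᶜ := rfl

/-- No bubble hits the empty set. [folklore] -/
@[simp] theorem hit_empty : hit (∅ : Set ℂ) = ∅ := by
  ext K
  simp

/-- **The σ-field on `Ω_b`**: generated by the avoidance events `{K ∩ A = ∅}`, `A ∈ 𝒬*` (as for
`Ω` in [LSW] §3 and `Ω₊` in §8.1; the hitting events of (7.2) are their complements).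
[cite: LawlerSchrammWerner2003Restriction, §7.1 (p. 28) with §3 (p. 10)] -/
instance instMeasurableSpace : MeasurableSpace BubbleConfig :=
  MeasurableSpace.generateFrom {S | ∃ A, IsStarHull A ∧ S = avoid A}

/-- Avoidance events of `*`-hulls are measurable. [folklore] -/
theorem measurableSet_avoid {A : Set ℂ} (hA : IsStarHull A) : MeasurableSet (avoid A) :=
  MeasurableSpace.measurableSet_generateFrom ⟨A, hA, rfl⟩

/-- Hitting events of `*`-hulls are measurable. [folklore] -/
theorem measurableSet_hit {A : Set ℂ} (hA : IsStarHull A) : MeasurableSet (hit A) :=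
  (measurableSet_avoid hA).compl

/-! #### An example: the vertical segment `(0, i]` -/

/-- The segment `{i t : 0 < t ≤ 1}` in coordinates. [folklore] -/
theorem image_mul_I_Ioc :
    (fun t : ℝ ↦ (Complex.I * t : ℂ)) '' Ioc 0 1 = {z : ℂ | z.re = 0 ∧ 0 < z.im ∧ z.im ≤ 1} := by
  ext z
  constructor
  · rintro ⟨t, ⟨ht0, ht1⟩, rfl⟩
    exact ⟨by simp, by simpa using ht0, by simpa using ht1⟩
  · rintro ⟨h1, h2, h3⟩
    exact ⟨z.im, ⟨h2, h3⟩, Complex.ext (by simp [h1]) (by simp)⟩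

/-- The segment `{i t : 0 ≤ t ≤ 1}` in coordinates. [folklore] -/
theorem image_mul_I_Icc :
    (fun t : ℝ ↦ (Complex.I * t : ℂ)) '' Icc 0 1 = {z : ℂ | z.re = 0 ∧ 0 ≤ z.im ∧ z.im ≤ 1} := by
  ext z
  constructor
  · rintro ⟨t, ⟨ht0, ht1⟩, rfl⟩
    exact ⟨by simp, by simpa using ht0, by simpa using ht1⟩
  · rintro ⟨h1, h2, h3⟩
    exact ⟨z.im, ⟨h2, h3⟩, Complex.ext (by simp [h1]) (by simp)⟩

/-- **The vertical segment `(0, i]` is a bubble** (`Ω_b ≠ ∅`): it lies in `ℍ`, is bounded and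
connected, its closure adds exactly the root `0`, and `ℍ ∖ (0, i]` is star-shaped about `2i`,
hence connected. [folklore] -/
def verticalSegment : BubbleConfig :=
  ⟨(fun t : ℝ ↦ (Complex.I * t : ℂ)) '' Ioc 0 1, by
    refine ⟨?_, ?_, ?_, ?_, ?_⟩
    · rintro _ ⟨t, ht, rfl⟩
      show 0 < (Complex.I * t : ℂ).im
      simpa using ht.1
    · exact RestrictionConfig.isometry_mul_I.lipschitz.isBounded_image
        ((Metric.isBounded_Icc (0 : ℝ) 1).subset Ioc_subset_Icc_self)
    · exact (isConnected_Ioc zero_lt_one).image _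
        RestrictionConfig.isometry_mul_I.continuous.continuousOn
    · rw [RestrictionConfig.isometry_mul_I.isClosedEmbedding.closure_image_eq, closure_Ioc zero_ne_one,
        image_mul_I_Icc, image_mul_I_Ioc]
      ext z
      simp only [mem_setOf_eq, mem_union, mem_singleton_iff]
      constructor
      · rintro ⟨h1, h2, h3⟩
        rcases h2.eq_or_lt with h | h
        · exact Or.inr (Complex.ext (by simp [h1]) (by simp [← h]))
        · exact Or.inl ⟨h1, h, h3⟩
      · rintro (⟨h1, h2, h3⟩ | rfl)
        · exact ⟨h1, h2.le, h3⟩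
        · simp
    · -- `ℍ ∖ (0, i]` is star-shaped about `2i`
      rw [image_mul_I_Ioc]
      have hstar : StarConvex ℝ (2 * Complex.I) (upperHalfPlaneSet \ {z : ℂ | z.re = 0 ∧ 0 < z.im ∧ z.im ≤ 1}) := by
        intro z hz a b ha hb hab
        have hzim : 0 < z.im := hz.1
        refine ⟨?_, ?_⟩
        · show 0 < (a • (2 * Complex.I) + b • z).im
          simp only [Complex.add_im, Complex.smul_im, smul_eq_mul, Complex.mul_im, Complex.I_re,
            Complex.I_im, Complex.re_ofNat, Complex.im_ofNat]
          rcases ha.eq_or_lt with rfl | ha'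
          · simp only [zero_add] at hab
            subst hab
            simpa using hzim
          · nlinarith
        · rintro ⟨hre, him, him1⟩
          simp only [Complex.add_re, Complex.smul_re, smul_eq_mul, Complex.mul_re, Complex.I_re,
            Complex.I_im, Complex.re_ofNat, Complex.im_ofNat, Complex.add_im, Complex.smul_im,
            Complex.mul_im] at hre him him1
          rcases eq_or_ne b 0 with rfl | hb0
          · simp only [zero_mul, add_zero] at him1 hab
            subst hab
            norm_num at him1
          · have hzre : z.re = 0 := by
              have : b * z.re = 0 := by linarith
              exact (mul_eq_zero.1 this).resolve_left hb0
            -- `z` itself is then on the segment or above it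
            have hb' : 0 < b := lt_of_le_of_ne hb hb0.symm
            by_cases hz1 : z.im ≤ 1
            · exact hz.2 ⟨hzre, hzim, hz1⟩
            · rw [not_le] at hz1
              -- `a * 2 + b * z.im > a * 1 + b * 1 = 1`... contradiction with `≤ 1`
              nlinarith
      have hmem : 2 * Complex.I ∈ upperHalfPlaneSet \ {z : ℂ | z.re = 0 ∧ 0 < z.im ∧ z.im ≤ 1} :=
        ⟨by show (0 : ℝ) < (2 * Complex.I).im; simp, fun h ↦ by norm_num at h⟩
      exact (hstar.isPathConnected hmem).isConnected⟩

/-- `Ω_b` is nonempty. [folklore] -/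
instance instNonempty : Nonempty BubbleConfig := ⟨verticalSegment⟩

end BubbleConfig

/-! ### The jet of `Φ_A` at `0` and the Schwarzian `−SΦ_A(0)/6` -/

/-- **Third-order jet of a restriction map at `0`**: `Φ(z) = d z + c₂ z² + c₃ z³ + o(z³)` as
`z → 0` inside `ℍ ∖ A`, with REAL coefficients `d = Φ'(0)`, `c₂ = Φ''(0)/2`, `c₃ = Φ‴(0)/6`
(the derivatives of the Schwarz-reflected extension of `Φ_A` across `ℝ` near `0 ∉ A`, which is
real on `ℝ`: [LSW] p. 7 "the maps may be extended to a neighborhood of `0` by Schwarz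
reflection"; [Lawler] proof of Prop. 5.22: "`f(z) = z + x z² + [x² − hcap(A)] z³ + ⋯`"). Stated
as a limit inside `ℍ ∖ A`, like the tree's `HasRestrictionDeriv`.
[cite: Lawler2005, proof of Prop. 5.22 (§5.5)] -/
def HasRestrictionJet (A : Set ℂ) (Φ : ConformalEquiv (upperHalfPlaneSet \ A) upperHalfPlaneSet)
    (d c₂ c₃ : ℝ) : Prop :=
  Tendsto (fun z ↦ (Φ z - ((d : ℂ) * z + (c₂ : ℂ) * z ^ 2 + (c₃ : ℂ) * z ^ 3)) / z ^ 3)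
    (𝓝[upperHalfPlaneSet \ A] 0) (𝓝 0)

/-- Points of `ℍ ∖ A` are nonzero (local copy of `RestrictionSemigroup`'s lemma). [folklore] -/
private theorem ne_zero_of_mem_diff' {A : Set ℂ} {z : ℂ} (hz : z ∈ upperHalfPlaneSet \ A) : z ≠ 0 := by
  rintro rfl
  have : (0 : ℝ) < (0 : ℂ).im := hz.1
  simp at this

/-- **A jet refines the derivative number**: `HasRestrictionJet A Φ d c₂ c₃ → HasRestrictionDeriv A Φ d`
(`Φ(z)/z − d = R(z) z² + c₂ z + c₃ z²` with `R(z) = (Φ(z) − d z − c₂ z² − c₃ z³)/z³ → 0`). [folklore] -/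
theorem HasRestrictionJet.hasRestrictionDeriv {A : Set ℂ}
    {Φ : ConformalEquiv (upperHalfPlaneSet \ A) upperHalfPlaneSet} {d c₂ c₃ : ℝ}
    (h : HasRestrictionJet A Φ d c₂ c₃) : HasRestrictionDeriv A Φ d := by
  unfold HasRestrictionDeriv
  -- the correction terms tend to `0`
  have hz : Tendsto (fun z : ℂ ↦ z) (𝓝[upperHalfPlaneSet \ A] 0) (𝓝 0) :=
    tendsto_nhdsWithin_of_tendsto_nhds tendsto_id
  have hcorr : Tendsto (fun z : ℂ ↦
      (Φ z - ((d : ℂ) * z + (c₂ : ℂ) * z ^ 2 + (c₃ : ℂ) * z ^ 3)) / z ^ 3 * z ^ 2 +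
        (c₂ : ℂ) * z + (c₃ : ℂ) * z ^ 2 + d) (𝓝[upperHalfPlaneSet \ A] 0) (𝓝 (d : ℂ)) := by
    have h1 := (h.mul (hz.pow 2)).add (((tendsto_const_nhds (x := (c₂ : ℂ))).mul hz).add
      ((tendsto_const_nhds (x := (c₃ : ℂ))).mul (hz.pow 2)))
    have h2 := h1.add (tendsto_const_nhds (x := (d : ℂ)))
    simp only [zero_pow two_ne_zero, mul_zero, zero_add, add_zero] at h2
    simpa [add_assoc] using h2
  refine hcorr.congr' (eventually_nhdsWithin_of_forall fun z hz' ↦ ?_)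
  have hz0 : z ≠ 0 := ne_zero_of_mem_diff' hz'
  field_simp
  ring

/-- **The jet of `Φ_∅ = id` is `(1, 0, 0)`** (non-vacuity of `HasRestrictionJet`). [folklore] -/
theorem hasRestrictionJet_empty : HasRestrictionJet ∅ restrictionMapEmpty 1 0 0 := by
  unfold HasRestrictionJet
  refine (tendsto_const_nhds (x := (0 : ℂ))).congr' (eventually_nhdsWithin_of_forall fun z _ ↦ ?_)
  simp

/-- **The bubble hitting mass `−SΦ_A(0)/6` in terms of the jet** ([LSW] (7.2) with (5.1);
[Lawler] Prop. 5.22): for `Φ(z) = d z + c₂ z² + c₃ z³ + o(z³)`, the Schwarzian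
`SΦ = Φ‴/Φ′ − (3/2)(Φ″/Φ′)²` at `0` is `6c₃/d − 6c₂²/d²`, so `−SΦ(0)/6 = c₂²/d² − c₃/d`; for
`d = 1`, `c₂ = x`, `c₃ = x² − hcap(A)` this is `hcap(A)`, the half-plane capacity of the
inverted hull `{−1/z : z ∈ A}`. [cite: Lawler2005, Prop. 5.22 (§5.5)] -/
def bubbleMass (d c₂ c₃ : ℝ) : ℝ := c₂ ^ 2 / d ^ 2 - c₃ / d

/-- The identity map has no bubble mass (`A = ∅` is hit by no bubble). [folklore] -/
@[simp] theorem bubbleMass_one_zero_zero : bubbleMass 1 0 0 = 0 := by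
  simp [bubbleMass]

/-- NAMED FACT — **restriction maps have a real third-order jet at `0`** ([LSW] p. 7: `Φ_A`
extends to a neighborhood of `0` by Schwarz reflection in the real line — so it is analytic at
`0` with real Taylor coefficients, being real on `ℝ`; [Lawler] proof of Prop. 5.22: "`f(z) = z +
x z² + [x² − hcap(A)] z³ + ⋯`"): for `A ∈ 𝒬*` and a restriction map `Φ` of `A` there are real
`d, c₂, c₃` with `Φ(z) = d z + c₂ z² + c₃ z³ + o(z³)` in `ℍ ∖ A`. (The tree's `reflectExt`,
`KernelConvergence`, provides the holomorphic extension; the Taylor expansion with real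
coefficients is not spelled out there.) [cite: Lawler2005, proof of Prop. 5.22 (§5.5)] -/
def IsStarHull.exists_hasRestrictionJet : Prop :=
  ∀ {A : Set ℂ}, IsStarHull A →
    ∀ {Φ : ConformalEquiv (upperHalfPlaneSet \ A) upperHalfPlaneSet}, IsRestrictionMap A Φ →
      ∃ d c₂ c₃ : ℝ, HasRestrictionJet A Φ d c₂ c₃

/-! ### The Brownian bubble measure `μ` ([LSW] §7.1 (7.2); [Lawler] §5.5) -/

/-- **Brownian bubble measure at `0`, characterised by its hitting masses** ([LSW] §7.1, (7.2):
"`μ[K ∩ A ≠ ∅] = −S g_A(0)/6`" for `A ∈ 𝒬*`, `μ` "a measure on the space `Ω_b`"; [Lawler]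
Prop. 5.22: "`μ^bub_ℍ(0){γ : γ(0, t_γ) ⊄ D} = hcap(A) = −Sf(0)/6`"): a measure `μ` on `Ω_b`
such that for every `A ∈ 𝒬*`, every restriction map `Φ` of `A` and every jet
`Φ(z) = d z + c₂ z² + c₃ z³ + o(z³)`, `μ{K : K ∩ A ≠ ∅} = c₂²/d² − c₃/d (= −SΦ_A(0)/6)`. In
[LSW] `μ` is CONSTRUCTED (the image under `z ↦ −1/z` of
`ν = (1/π) lim_{y → ∞} y ∫_ℝ P̂^{x+iy} dx`, `P̂^z` the law of the filling of a Brownian excursion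
from `z`) and (7.2) is derived; here (7.2) is the definition and the construction is the
existence fact `exists_isBrownianBubbleMeasure`. (7.2) is all that [LSW] §7.2 uses of `μ`.
[cite: LawlerSchrammWerner2003Restriction, §7.1 eq. (7.2) (p. 28)] -/
def IsBrownianBubbleMeasure (μ : Measure BubbleConfig) : Prop :=
  ∀ {A : Set ℂ}, IsStarHull A →
    ∀ {Φ : ConformalEquiv (upperHalfPlaneSet \ A) upperHalfPlaneSet}, IsRestrictionMap A Φ →
      ∀ {d c₂ c₃ : ℝ}, HasRestrictionJet A Φ d c₂ c₃ →
        μ (BubbleConfig.hit A) = ENNReal.ofReal (bubbleMass d c₂ c₃)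

/-- Consistency check: a Brownian bubble measure gives mass `0` to hitting the empty hull (both
sides vanish: `hit ∅ = ∅` and the jet of `Φ_∅ = id` has `bubbleMass 1 0 0 = 0`). [folklore] -/
theorem IsBrownianBubbleMeasure.measure_hit_empty {μ : Measure BubbleConfig}
    (h : IsBrownianBubbleMeasure μ) : μ (BubbleConfig.hit ∅) = 0 := by
  rw [h isStarHull_empty isRestrictionMap_empty hasRestrictionJet_empty]
  simp

/-- NAMED FACT — **existence of the Brownian bubble measure** ([LSW] §7.1, pp. 27–28: the
measure `ν` of Brownian bubbles hanging at infinity, "a σ-finite but infinite measure", exists as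
the limit (7.1) `ν := (1/π) lim_{y→∞} y ∫_ℝ P̂^{x+iy} dx` — "The existence of the limit is
easily justified" by the strong Markov property of excursions — satisfies
`ν[K ∩ A ≠ ∅] = a(A)` by Lemma 4.3, and `μ`, its image under `z ↦ −1/z`, satisfies (7.2) by
(5.1); [Lawler] §5.5 defines `μ^bub_ℍ(0) = lim_{x→0+} π μ_ℍ(0, x)` and proves Prop. 5.22): there
is a measure on `Ω_b` with the hitting masses (7.2). Not in the tree: Brownian excursions from
`z ∈ ℍ` (§4), their fillings as random elements of a space of closed sets, the limit (7.1),
the half-plane capacity `a(A)` and (5.1).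
[cite: LawlerSchrammWerner2003Restriction, §7.1 eqs. (7.1)–(7.2) (pp. 27–28)] -/
def exists_isBrownianBubbleMeasure : Prop :=
  ∃ μ : Measure BubbleConfig, IsBrownianBubbleMeasure μ

/-- NAMED FACT (folklore) — **Brownian bubbles have interior points**: for a Brownian bubble
measure `μ`, `μ`-almost every `K ∈ Ω_b` has nonempty interior. A bubble is the filling (the
complement of the unbounded component of the complement, [LSW] §2 "Fillings", §7.1) of a
Brownian loop in `ℍ` rooted at `0` ([LSW] §7.1: `ν` "as a measure on paths, rather than
fillings" is a two-sided Brownian excursion; [Lawler] §5.5: `μ^bub_ℍ(0)` lives on curves `γ` with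
`γ(0) = γ(t_γ) = 0`), and a planar Brownian path run for positive time almost surely
disconnects a nonempty open set from infinity (it performs closed loops around points at
every scale), so its filling has interior points. This is the property by which the samples of
`P_α`, `α > 5/8` — SLE_κ decorated with a Poisson cloud of such bubbles, [LSW] Thm. 7.3 — are
not simple curves. (For the measure characterised by (7.2) this presupposes that (7.2)
determines `μ`, see the module docstring.) [folklore] -/
def IsBrownianBubbleMeasure.ae_interior_nonempty : Prop :=
  ∀ {μ : Measure BubbleConfig}, IsBrownianBubbleMeasure μ →
    ∀ᵐ K : BubbleConfig ∂μ, (interior (K : Set ℂ)).Nonempty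

end Literature.Probability.RandomPlanarGeometry

end
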